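import Summits.QuantumFields.YangMills.Theorems.UnitScaleTiltProp7TransplantNearDatum
import HarnessLib

/-!
# Route `UnitScaleTilt`, crux K1 «MinimiserStabilityRegPr» (stmt-QuantumFields-19200), route-R E′ path (α′), (E1-b) at the CURVED background — (A-cov) gen-0, FILE «GEN-0 PACKAGE»:
# THE WHOLE gen-0 SIDE OF ONE BOND IN ONE `obtain` — at cutoff scale `n := L^k` (the centre spacing), for a bi-contractive pair `U, Fr` with CONE rows in the explicit letters
# `t₁ z := A₁·(tdist(z,b) + 1)`, `t₂ z := A₀ + A₂·(tdist(z,b) + 2)` on the ball `S′ = {tdist(·,b) ≤ 9L^k + L^k}` and a weight `0 ≤ ω ≤ Ω` there: the scalars `ψ g c₁ c₂`, the near scalar `ψ̃`, their identities,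
# and the FIVE gen-0 numbers `N2₀ N3₀ N4₀ H₀ S₀` of ✓ `htr_body_of_rows''` as explicit functions of `(L^k, C, A₀, A₁, A₂, Ω, √hs X, ‖X‖)`, plus gen-1's input density of `E₂`

Cell `ym3-torus`, width seat `ym3-torus-px22` (gen 3); one `obtain` of ✓p679067 `exists_gen0_numbers` (at `n := L^k`, rows restricted from `S′` to `S = {tdist ≤ 9L^k}`) and one of ✓p679731
`exists_nearDatum_numbers` (same `ψ`).  THEOREMS ONLY (0 `def`, 0 `sorry`); `--supports stmt-QuantumFields-19200`, count-neutral.  YM₃ on T³ is a ladder rung (R3), not the Clay problem; nothing here claims the stub,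
the crux, d = 4 or the gap.

WHAT IS PROVED (ns `…Theorems.Prop7TransplantGen0Package`).
* `mem_big_of_mem_small` (`S ⊆ S′`), ★★★ `exists_gen0_package` (see the title; the member file feeds it routeR-w4's anchored cone frame, ✓ `exists_weight_rows`' weight and `X`).
HONEST SCOPE.  Plumbing; the `ℓ`-bookkeeping of the five numbers (`≤ c₀·L^k·√hs X`) and gen-1's five numbers are the remaining inputs of `htot`.

References: T. Bałaban, CMP 99 (1985) 389–434 [Balaban1985BackgroundPropagators] ((3.8) p.392, (3.35) p.396); CMP 96 (1984) 223–250 [Balaban1984PropagatorsII] ((1.9) p.226); CMP 99 (1985) 75–102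
[Balaban1985RegularSpaces] ((1.14) p.78, (1.36) p.82).
-/

set_option autoImplicit false

noncomputable section

open scoped BigOperators Matrix.Norms.L2Operator Matrix
open Finset

namespace Summit.QuantumFields.YangMills.Theorems.Prop7TransplantGen0Package

open Literature.MathematicalPhysics.QuantumFieldTheory.Balaban1983to89
open B9Eq39Adjoint (R R_def covD covDstar divB)
open B9TorusCalculus (torusT torusT_apply torusT_symm_apply)
open B15DeterminingSets (embIter)
open Prop7TransplantGen0Numbers (exists_gen0_numbers)
open Prop7TransplantNearDatum (exists_nearDatum_numbers)

variable {P : Params}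

/-- `S = {tdist ≤ 9L^k} ⊆ S′ = {tdist ≤ 9L^k + L^k}`. [folklore] -/
theorem mem_big_of_mem_small (b z : Site P 0) (k : ℕ) (hz : z ∈ (univ.filter fun z : Site P 0 => Site.tdist z b ≤ 9 * P.L ^ k)) :
    z ∈ (univ.filter fun z : Site P 0 => Site.tdist z b ≤ 9 * P.L ^ k + P.L ^ k) := by
  simp only [Finset.mem_filter, Finset.mem_univ, true_and] at hz ⊢
  omega

set_option maxHeartbeats 400000 in
/-- ★★★ **THE gen-0 PACKAGE OF ONE BOND** (see the module docstring). [cite: Balaban1985BackgroundPropagators, (3.8) p.392, (3.35) p.396; Balaban1984PropagatorsII, (1.9) p.226; Balaban1985RegularSpaces, (1.14) p.78, (1.36) p.82] -/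
theorem exists_gen0_package : ∃ C : ℝ, 0 ≤ C ∧ ∀ (P : Params) (_ : P.d = 3) (k : ℕ) (hk : k ≤ P.m + P.K) (_ : 3 ≤ P.L ^ k)
    (b : Site P 0) (μ₀ : Fin P.d) {N : ℕ}
    (U : Fin P.d → Site P 0 → (Matrix (Fin N) (Fin N) ℂ)ˣ) (Fr : Site P 0 → (Matrix (Fin N) (Fin N) ℂ)ˣ)
    (_ : ∀ (κ : Fin P.d) (y : Site P 0), ‖(U κ y : Matrix (Fin N) (Fin N) ℂ)‖ ≤ 1 ∧ ‖(((U κ y)⁻¹ : (Matrix (Fin N) (Fin N) ℂ)ˣ) : Matrix (Fin N) (Fin N) ℂ)‖ ≤ 1)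
    (_ : ∀ z : Site P 0, ‖(Fr z : Matrix (Fin N) (Fin N) ℂ)‖ ≤ 1 ∧ ‖(((Fr z)⁻¹ : (Matrix (Fin N) (Fin N) ℂ)ˣ) : Matrix (Fin N) (Fin N) ℂ)‖ ≤ 1)
    (A₀ A₁ A₂ : ℝ) (_ : 0 ≤ A₀) (_ : 0 ≤ A₁) (_ : 0 ≤ A₂)
    (_ : ∀ z ∈ (univ.filter fun z : Site P 0 => Site.tdist z b ≤ 9 * P.L ^ k + P.L ^ k), ∀ μ,
      ‖(((Fr z)⁻¹ * U μ z * Fr (torusT P 0 μ z) : (Matrix (Fin N) (Fin N) ℂ)ˣ) : Matrix (Fin N) (Fin N) ℂ) - 1‖ ≤ A₁ * ((Site.tdist z b : ℝ) + 1))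
    (_ : ∀ z ∈ (univ.filter fun z : Site P 0 => Site.tdist z b ≤ 9 * P.L ^ k + P.L ^ k), ∀ μ,
      ‖(((Fr ((torusT P 0 μ).symm z))⁻¹ * U μ ((torusT P 0 μ).symm z) * Fr (torusT P 0 μ ((torusT P 0 μ).symm z)) : (Matrix (Fin N) (Fin N) ℂ)ˣ) :
        Matrix (Fin N) (Fin N) ℂ) - 1‖ ≤ A₁ * ((Site.tdist z b : ℝ) + 1))
    (_ : ∀ z ∈ (univ.filter fun z : Site P 0 => Site.tdist z b ≤ 9 * P.L ^ k + P.L ^ k), ∀ μ,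
      ‖(((Fr z)⁻¹ * U μ z * Fr (torusT P 0 μ z) : (Matrix (Fin N) (Fin N) ℂ)ˣ) : Matrix (Fin N) (Fin N) ℂ)
        - (((Fr ((torusT P 0 μ).symm z))⁻¹ * U μ ((torusT P 0 μ).symm z) * Fr (torusT P 0 μ ((torusT P 0 μ).symm z)) : (Matrix (Fin N) (Fin N) ℂ)ˣ) :
          Matrix (Fin N) (Fin N) ℂ)‖ ≤ A₀ + A₂ * ((Site.tdist z b : ℝ) + 2))
    (X : Matrix (Fin N) (Fin N) ℂ) (ω : Site P 0 → ℝ) (Ω : ℝ) (_ : ∀ z ∈ (univ.filter fun z : Site P 0 => Site.tdist z b ≤ 9 * P.L ^ k + P.L ^ k), 0 ≤ ω z ∧ ω z ≤ Ω),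
    ∃ ψ g c₁ c₂ ψt : Site P 0 → ℝ,
      -- identities and the near datum on the centres
      (∀ z, ∑ ν : Fin P.d, (2 * ψ z - ψ (torusT P 0 ν z) - ψ ((torusT P 0 ν).symm z)) = g z + c₁ z) ∧
      (∀ z, ∑ ν : Fin P.d, (2 * g z - g (torusT P 0 ν z) - g ((torusT P 0 ν).symm z))
        = ((if z = b.shift μ₀ then (1 : ℝ) else 0) - (if z = b then (1 : ℝ) else 0)) + c₂ z) ∧
      (∀ y ∈ Set.range (embIter k), ψt y = ψ y) ∧
      -- (N2₀)
      (∑ z, Real.sqrt (∑ j : Fin N, ∑ k' : Fin N, ‖(divB (torusT P 0) U (fun μ => covD (torusT P 0) U μ (fun y => ψ y • R (Fr y) X)) z) j k'‖ ^ 2)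
        ≤ Real.sqrt (∑ j : Fin N, ∑ k' : Fin N, ‖X j k'‖ ^ 2) * (C * (9 + 192 * (9 * (P.L ^ k : ℕ))) + (2 * ((9 * (P.L ^ k : ℕ) : ℝ) + 1)) ^ P.d * (C / ((P.L ^ k : ℕ) : ℝ) ^ 2))
          + Real.sqrt N * (‖X‖ * ((2 * ((9 * (P.L ^ k : ℕ) : ℝ) + 1)) ^ P.d
            * (P.d * ((2 * (A₀ + A₂ * (9 * (P.L ^ k : ℕ) + 2)) + 4 * (A₁ * (9 * (P.L ^ k : ℕ) + 1)) ^ 2) * C + 8 * A₁ * C))))) ∧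
      -- (H₀) for the defined `E₁`
      (∀ E₁ : Site P 0 → Matrix (Fin N) (Fin N) ℂ,
        (∀ z, E₁ z = divB (torusT P 0) U (fun μ => covD (torusT P 0) U μ (fun y => ψ y • R (Fr y) X)) z
          - (∑ ν : Fin P.d, (2 * ψ z - ψ (torusT P 0 ν z) - ψ ((torusT P 0 ν).symm z))) • R (Fr z) X) →
        Real.sqrt (∑ z, ω z ^ 2 * ∑ j : Fin N, ∑ k' : Fin N, ‖(E₁ z + c₁ z • R (Fr z) X) j k'‖ ^ 2)
          ≤ Ω * Real.sqrt (((univ.filter fun z : Site P 0 => Site.tdist z b ≤ 9 * P.L ^ k)).card : ℝ)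
            * (Real.sqrt N * (P.d * ((2 * (A₀ + A₂ * (9 * (P.L ^ k : ℕ) + 2)) + 4 * (A₁ * (9 * (P.L ^ k : ℕ) + 1)) ^ 2) * C + 8 * A₁ * C) * ‖X‖)
              + C / ((P.L ^ k : ℕ) : ℝ) ^ 2 * Real.sqrt (∑ j : Fin N, ∑ k' : Fin N, ‖X j k'‖ ^ 2))) ∧
      -- (S₀)
      Real.sqrt (∑ z, ω z ^ 2 * ∑ j : Fin N, ∑ k' : Fin N, ‖(c₂ z • R (Fr z) X) j k'‖ ^ 2)
        ≤ Ω * Real.sqrt (((univ.filter fun z : Site P 0 => Site.tdist z b ≤ 9 * P.L ^ k)).card : ℝ) * (C / ((P.L ^ k : ℕ) : ℝ) ^ 4 * Real.sqrt (∑ j : Fin N, ∑ k' : Fin N, ‖X j k'‖ ^ 2)) ∧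
      -- (N3₀), (N4₀)
      (∑ z, Real.sqrt (∑ j : Fin N, ∑ k' : Fin N, ‖(divB (torusT P 0) U (fun μ => covD (torusT P 0) U μ (fun y => ψt y • R (Fr y) X)) z) j k'‖ ^ 2)
        ≤ (2 * ((9 * (P.L ^ k : ℕ) : ℝ) + (P.L : ℝ) ^ k + 1)) ^ P.d
          * (C * (9 * P.d * (10 * Real.sqrt P.d + 6) ^ 2 / ((P.L : ℝ) ^ k) ^ 2) * Real.sqrt (∑ j : Fin N, ∑ k' : Fin N, ‖X j k'‖ ^ 2)
            + Real.sqrt N * ‖X‖ * (P.d * ((2 * (A₀ + A₂ * ((9 * (P.L ^ k : ℕ) : ℝ) + (P.L : ℝ) ^ k + 2)) + 4 * (A₁ * ((9 * (P.L ^ k : ℕ) : ℝ) + (P.L : ℝ) ^ k + 1)) ^ 2) * C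
              + 4 * (A₁ * ((9 * (P.L ^ k : ℕ) : ℝ) + (P.L : ℝ) ^ k + 1)) * (C * (3 * (10 * Real.sqrt P.d + 6) / (2 * ((P.L : ℝ) ^ k)))))))) ∧
      (Real.sqrt (∑ z, ω z ^ 2 * ∑ j : Fin N, ∑ k' : Fin N, ‖(divB (torusT P 0) U (fun μ => covD (torusT P 0) U μ (fun y => ψt y • R (Fr y) X)) z) j k'‖ ^ 2)
        ≤ Ω * Real.sqrt ((2 * ((9 * (P.L ^ k : ℕ) : ℝ) + (P.L : ℝ) ^ k + 1)) ^ P.d)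
          * (C * (9 * P.d * (10 * Real.sqrt P.d + 6) ^ 2 / ((P.L : ℝ) ^ k) ^ 2) * Real.sqrt (∑ j : Fin N, ∑ k' : Fin N, ‖X j k'‖ ^ 2)
            + Real.sqrt N * ‖X‖ * (P.d * ((2 * (A₀ + A₂ * ((9 * (P.L ^ k : ℕ) : ℝ) + (P.L : ℝ) ^ k + 2)) + 4 * (A₁ * ((9 * (P.L ^ k : ℕ) : ℝ) + (P.L : ℝ) ^ k + 1)) ^ 2) * C
              + 4 * (A₁ * ((9 * (P.L ^ k : ℕ) : ℝ) + (P.L : ℝ) ^ k + 1)) * (C * (3 * (10 * Real.sqrt P.d + 6) / (2 * ((P.L : ℝ) ^ k)))))))) ∧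
      -- gen-1's input: the density and vanishing of `E₂`
      (∀ E₂ : Site P 0 → Matrix (Fin N) (Fin N) ℂ,
        (∀ z, E₂ z = divB (torusT P 0) U (fun μ => covD (torusT P 0) U μ (fun y => g y • R (Fr y) X)) z
          - (∑ ν : Fin P.d, (2 * g z - g (torusT P 0 ν z) - g ((torusT P 0 ν).symm z))) • R (Fr z) X) →
        (∀ z ∈ (univ.filter fun z : Site P 0 => Site.tdist z b ≤ 9 * P.L ^ k),
          ‖E₂ z‖ ≤ P.d * (((2 * (A₀ + A₂ * (9 * (P.L ^ k : ℕ) + 2)) + 4 * (A₁ * (9 * (P.L ^ k : ℕ) + 1)) ^ 2) * C + 8 * A₁ * C)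
            / (max 1 ((Site.tdist z b : ℕ) : ℝ)) ^ 2) * ‖X‖) ∧
        (∀ z ∉ (univ.filter fun z : Site P 0 => Site.tdist z b ≤ 9 * P.L ^ k), E₂ z = 0)) := by
  obtain ⟨C, hC, H⟩ := exists_gen0_numbers
  refine ⟨C, hC, ?_⟩
  intro P hd k hk h3 b μ₀ N U Fr hU hFr A₀ A₁ A₂ hA₀ hA₁ hA₂ h1 h1' h2 X ω Ω hω
  classical
  have hn2 : 2 ≤ P.L ^ k := le_trans (by norm_num) h3
  obtain ⟨ψ, g, c₁, c₂, hsupp, hsuppc, hid1, hid2, hψ0, hψ1, hc₁, hc₂, HN⟩ := H P hd k hk b μ₀ (P.L ^ k) hn2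
  -- the cone rows restricted to the small ball, with `t₁ t₂` the explicit cone functions
  have ht₁ : ∀ z ∈ (univ.filter fun z : Site P 0 => Site.tdist z b ≤ 9 * P.L ^ k),
      0 ≤ A₁ * ((Site.tdist z b : ℝ) + 1) ∧ A₁ * ((Site.tdist z b : ℝ) + 1) ≤ A₁ * ((Site.tdist z b : ℝ) + 1) := fun z _ => ⟨by positivity, le_rfl⟩
  have ht₂ : ∀ z ∈ (univ.filter fun z : Site P 0 => Site.tdist z b ≤ 9 * P.L ^ k),
      A₀ + A₂ * ((Site.tdist z b : ℝ) + 2) ≤ A₀ + A₂ * ((Site.tdist z b : ℝ) + 2) := fun z _ => le_rfl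
  have hωS : ∀ z ∈ (univ.filter fun z : Site P 0 => Site.tdist z b ≤ 9 * P.L ^ k), 0 ≤ ω z ∧ ω z ≤ Ω := fun z hz => hω z (mem_big_of_mem_small b z k hz)
  obtain ⟨hN2, hE1, hS0, hE2⟩ := HN U Fr hU hFr (fun z => A₁ * ((Site.tdist z b : ℝ) + 1)) (fun z => A₀ + A₂ * ((Site.tdist z b : ℝ) + 2)) A₀ A₁ A₂ hA₀ hA₁ hA₂
    ht₁ ht₂ (fun z hz μ => h1 z (mem_big_of_mem_small b z k hz) μ) (fun z hz μ => h1' z (mem_big_of_mem_small b z k hz) μ)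
    (fun z hz μ => h2 z (mem_big_of_mem_small b z k hz) μ) X ω Ω hωS
  -- the near datum for the same `ψ`
  have hψsupp : ∀ z, (9 * (P.L ^ k : ℕ) : ℝ) ≤ (Site.tdist z b : ℝ) → ψ z = 0 := fun z hz => (hsupp z hz).1
  obtain ⟨ψt, hval, _, HT⟩ := exists_nearDatum_numbers (P := P) hk h3 b (P.L ^ k) ψ hC hψ0 hψsupp
  have ht₁' : ∀ z ∈ (univ.filter fun z : Site P 0 => Site.tdist z b ≤ 9 * P.L ^ k + P.L ^ k),
      0 ≤ A₁ * ((Site.tdist z b : ℝ) + 1) ∧ A₁ * ((Site.tdist z b : ℝ) + 1) ≤ A₁ * ((Site.tdist z b : ℝ) + 1) := fun z _ => ⟨by positivity, le_rfl⟩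
  have ht₂' : ∀ z ∈ (univ.filter fun z : Site P 0 => Site.tdist z b ≤ 9 * P.L ^ k + P.L ^ k),
      A₀ + A₂ * ((Site.tdist z b : ℝ) + 2) ≤ A₀ + A₂ * ((Site.tdist z b : ℝ) + 2) := fun z _ => le_rfl
  obtain ⟨hN3, hN4⟩ := HT U Fr hU hFr (fun z => A₁ * ((Site.tdist z b : ℝ) + 1)) (fun z => A₀ + A₂ * ((Site.tdist z b : ℝ) + 2)) A₀ A₁ A₂ hA₀ hA₁ hA₂
    ht₁' ht₂' h1 h1' h2 X ω Ω hω
  refine ⟨ψ, g, c₁, c₂, ψt, hid1, hid2, ?_, hN2, fun E₁ hE₁ => (hE1 E₁ hE₁).2.2, hS0, ?_, ?_, fun E₂ hE₂ => hE2 E₂ hE₂⟩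
  · rintro y ⟨y', rfl⟩
    exact hval y'
  · have e : ((P.L ^ k : ℕ) : ℝ) = (P.L : ℝ) ^ k := by push_cast; ring
    simpa only [e] using hN3
  · have e : ((P.L ^ k : ℕ) : ℝ) = (P.L : ℝ) ^ k := by push_cast; ring
    simpa only [e] using hN4

end Summit.QuantumFields.YangMills.Theorems.Prop7TransplantGen0Package

end
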